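import Summits.CriticalPhenomena.PercolationContinuityZ3.Theorems.PercNearOneGluingNoHeavyLowerTailSahiDefectExpansion
import Literature.Combinatorics.Sahi2008.Percolation
import Mathlib.Tactic.Linarith
import Mathlib.Tactic.Ring
import HarnessLib

/-!
# `NoHeavyLowerTail` (stmt-CriticalPhenomena-4575) — HIERARCHY LIFTING: Sahi positivity of order `k` ⇒ all orders on `(k+1)`-wise meet-absorbing families; `C_n` ∀`n` under triplewise meet containment

Support file, seat `prim-l12-p5` (gen 4), `--supports stmt-CriticalPhenomena-4575`.  No definitions, no named facts, no sorries.
Uses `…SahiDefectExpansion` ("Theorem E": `sahiE_cons_nonneg_of_absorbs_top` — hereditary positivity of `g` plus a head slot `d ≤ 1` absorbing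
the TOTAL product `∏ g` gives `E_{m+2}(d, g) ≥ (m + 1 − E d)·E_{m+1}(g) ≥ 0`) and `…SahiMeetTowerAllOrders` (Theorem D).

A sub-family `S` of slots is MEET-ABSORBING if some member `p` absorbs the product of the others, `(1 − g_p)·∏_{i∈S∖p} g_i = 0` (events:
`A_p ⊇ ⋂_{i∈S∖p} A_i`).  `exists_absorber_of_cardwise`: if all `k`-subsets are meet-absorbing, so are all larger sub-families.

**THEOREM G — hierarchy lifting** (`sahiE_nonneg_of_sahiPositive_of_absorbing`; any probability weight `μ ≥ 0` on a finite PREORDER, no lattice,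
no correlation inequality): if `μ` is Sahi-positive of order `k ≥ 1` (`SahiPositive μ k`) and every sub-family of size `≥ k + 1` of the monotone
indicators `g_0,…,g_{m−1}` is meet-absorbing, then `E_m(g) ≥ 0` (all `m`; all sub-families).  Strong induction on `m`: orders `≤ k` by hypothesis;
above, the absorber of the whole family goes to the head slot (`SahiMeetTowerAll.sahiE_update_eq_sahiE_cons`) and Theorem E applies, its
hereditary hypothesis being the induction hypothesis transported along the increasing enumeration of each sub-family.

**THEOREM F — `C_n` for all `n` under TRIPLEWISE MEET CONTAINMENT** (`sahiE_nonneg_of_triplewise_meetContainment`, = G at `k = 2` with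
`C_2` = FKG): for an FKG probability weight on a finite distributive lattice and monotone indicators such that AMONG ANY THREE ONE ABSORBS THE
PRODUCT OF THE OTHER TWO (events: among any three, one contains the intersection of the other two), `E_m ≥ 0` at every order, for the family and
all its sub-families.  For `m = 3` this is meet containment (`…SahiE3MeetContainment`, 93.2 % of the `k = 4` multiset triples): the lane's HARD
CORE (a triple in which every slot misses part of the others' meet) is the ONLY obstruction at every order.  Meet towers are triplewise
meet-contained (`exists_absorber_of_meetTower`, earliest slot), so Theorem D is the special case (`sahiE_nonneg_of_meetTower'`); STRICTLY:
`(x₀x₁, x₀x₂, x₁, x₂)` is triplewise meet-contained and a tower in no order.  Census (seat `code/hma_search.py`, distinct non-constant up-sets):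
`{0,1}^3`: 2 937 / 3 060 four-sets triplewise meet-contained, 54 of them towers in no order; `{0,1}^4` (400 000 random four-sets and five-sets):
triplewise 78.6 % / 60.9 %, tower in some order 72.5 % / 47.2 %.
Also: `sahiE_cons_nonneg_of_meetTower_of_absorbs_top` (+ `…_ge_…`): a meet tower capped by ANY `d ≤ 1` absorbing its total product (not
necessarily monotone) has `E_{m+2}(d,g) ≥ (m + 1 − E d)·E_{m+1}(g) ≥ 0` (`E₄(x₃ ∨ x₀x₁, x₂ ∨ x₀x₁, x₀, x₁) ≥ 0`).

**`C_3 ⇒ C_n`** (`sahiE_nonneg_of_sahiPositive_three_of_fourwise`, = G at `k = 3`): order-`3` positivity of the weight lifts to all orders on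
families in which among any FOUR slots one absorbs the product of the other three.  PRODUCT MEASURES (Kahn's setting, increasing events,
`bernoulliWeight p`): `bernoulliWeight_sahiE_ind_nonneg_of_triplewise`.  (The unconditional all-order consequence on `≤ 4` coins — `C_3` there is
the tree's kernel certificate `SahiC3Cube.sahiC3_of_card_le_four`, `native_decide` — is filed separately as the computational companion
`…SahiHereditaryMeetAbsorptionCubeFour`.)
-/

namespace Summit.CriticalPhenomena.PercolationContinuityZ3.Theorems

namespace SahiHereditaryMeetAbsorption

open Finset Function Literature.Combinatorics.Sahi2008 SahiMomentExpansion SahiDefectExpansion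
open scoped Nat

variable {α : Type*} [Fintype α]

/-! ### Lifting Sahi positivity of order `k` to all orders on `(k+1)`-wise meet-absorbing families -/

omit [Fintype α] in
/-- **Card-wise reduction**: if every sub-family of size `k` has a member absorbing the product of the others, so does every sub-family of
size `≥ k` (an absorber of a `k`-subset `T ⊆ S` absorbs `∏(S ∖ p)`, since `⋂(S ∖ p) ⊆ ⋂(T ∖ p)`). [this file] -/
theorem exists_absorber_of_cardwise {m k : ℕ} (g : Fin m → α → ℝ)
    (hk : ∀ S : Finset (Fin m), S.card = k → ∃ p ∈ S, ∀ x, (1 - g p x) * ∏ i ∈ S.erase p, g i x = 0)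
    (S : Finset (Fin m)) (hS : k ≤ S.card) :
    ∃ p ∈ S, ∀ x, (1 - g p x) * ∏ i ∈ S.erase p, g i x = 0 := by
  obtain ⟨T, hTS, hT⟩ := Finset.exists_subset_card_eq hS
  obtain ⟨p, hp, habs⟩ := hk T hT
  refine ⟨p, hTS hp, fun x => ?_⟩
  rw [← Finset.prod_sdiff (Finset.erase_subset_erase p hTS), mul_left_comm, habs x, mul_zero]

section Lifting

variable [Preorder α]

/-- **Hierarchy lifting ("Theorem G").**  Probability weight `μ ≥ 0` on a finite preorder with Sahi positivity of order `k ≥ 1`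
(`SahiPositive μ k`, hence of every order `≤ k`); `g_0,…,g_{m−1}` monotone `{0,1}`-valued such that every sub-family of size `≥ k + 1` has a
member absorbing the product of the others.  Then `E_m(g) ≥ 0` (every `m`; and every sub-family, the hypothesis being hereditary).  Proof:
strong induction on `m` — orders `≤ k` by hypothesis, above `k` the absorber of the whole family is moved to the head slot
(`SahiMeetTowerAll.sahiE_update_eq_sahiE_cons`) and "Theorem E" (`sahiE_cons_nonneg_of_absorbs_top`) applies, its hereditary hypothesis being
the induction hypothesis transported along the increasing enumeration of each sub-family.  No lattice structure and no correlation
inequality beyond the hypothesis `SahiPositive μ k`. [this file] -/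
theorem sahiE_nonneg_of_sahiPositive_of_absorbing {μ : α → ℝ} (hμ0 : ∀ a, 0 ≤ μ a) (hμ1 : ∑ a, μ a = 1) {k : ℕ}
    (hk1 : 1 ≤ k) (hk : SahiPositive μ k) :
    ∀ (m : ℕ) (g : Fin m → α → ℝ), (∀ i a, g i a = 0 ∨ g i a = 1) → (∀ i, Monotone (g i)) →
      (∀ S : Finset (Fin m), k + 1 ≤ S.card → ∃ p ∈ S, ∀ x, (1 - g p x) * ∏ i ∈ S.erase p, g i x = 0) →
      0 ≤ sahiE μ m g := by
  intro m
  induction m using Nat.strong_induction_on with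
  | _ m ih =>
    intro g h01 hmono habs
    have hg0 : ∀ i x, 0 ≤ g i x := fun i x => by rcases h01 i x with e | e <;> simp [e]
    have hg1 : ∀ i x, g i x ≤ 1 := fun i x => by rcases h01 i x with e | e <;> simp [e]
    rcases Nat.lt_or_ge m (k + 1) with hm | hm
    · exact (hk.anti hμ0 hμ1 (Nat.lt_succ_iff.mp hm)) g hg0 hmono
    · obtain ⟨n, rfl⟩ := Nat.exists_eq_add_of_le' (show 2 ≤ m by omega)
      obtain ⟨p, _, hp⟩ := habs univ (by simpa using hm)
      -- move the absorber `p` to the head slot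
      have hmove : sahiE μ (n + 2) g
          = sahiE μ (n + 2) (Fin.cons (g p) (p.removeNth g) : Fin (n + 2) → α → ℝ) := by
        conv_lhs => rw [← update_eq_self p g]
        exact SahiMeetTowerAll.sahiE_update_eq_sahiE_cons μ (n + 1) g p (g p)
      rw [hmove]
      refine sahiE_cons_nonneg_of_absorbs_top hμ0 hμ1 n (g p) (p.removeNth g)
        (fun i x => hg0 _ x) (hg1 p) ?_ ?_
      · -- the head absorbs the total product of the tail
        intro x
        have key := hp x
        have e : (univ : Finset (Fin (n + 2))).erase p = univ.image p.succAbove := by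
          rw [← Finset.compl_singleton, ← Fin.image_succAbove_univ]
        rw [e, Finset.prod_image (fun i _ j _ h => Fin.succAbove_right_injective h)] at key
        simpa only [Fin.removeNth] using key
      · -- every sub-family of the tail is absorbing above order `k` and shorter: induction hypothesis
        intro T _
        refine ih Tᶜ.card ((Finset.card_le_univ _).trans_lt (by simp)) _ (fun j x => h01 _ x)
          (fun j => hmono _) ?_
        intro S' hS'
        let e : Fin Tᶜ.card ↪ Fin (n + 2) :=
          ⟨fun j => p.succAbove (Tᶜ.orderEmbOfFin rfl j),
            fun j₁ j₂ h => (Tᶜ.orderEmbOfFin rfl).injective (Fin.succAbove_right_injective h)⟩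
        obtain ⟨q, hq, hq'⟩ := habs (S'.map e) (by rwa [Finset.card_map])
        obtain ⟨q', hq'S, rfl⟩ := Finset.mem_map.mp hq
        refine ⟨q', hq'S, fun x => ?_⟩
        have key := hq' x
        rw [← Finset.map_erase, Finset.prod_map] at key
        exact key

/-- **`C_3 ⇒ C_n` for all `n` on FOUR-WISE meet-absorbing families**: if the weight is Sahi-positive of order `3` (Sahi's / Kahn's conjecture
for it, or a theorem — e.g. product measures on `≤ 4` coins) and among any FOUR slots one absorbs the product of the other three, then `E_m ≥ 0`
for every `m`. [this file] -/
theorem sahiE_nonneg_of_sahiPositive_three_of_fourwise {μ : α → ℝ} (hμ0 : ∀ a, 0 ≤ μ a) (hμ1 : ∑ a, μ a = 1)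
    (h3 : SahiPositive μ 3) (m : ℕ) (g : Fin m → α → ℝ) (h01 : ∀ i a, g i a = 0 ∨ g i a = 1) (hmono : ∀ i, Monotone (g i))
    (h4 : ∀ S : Finset (Fin m), S.card = 4 → ∃ p ∈ S, ∀ x, (1 - g p x) * ∏ i ∈ S.erase p, g i x = 0) :
    0 ≤ sahiE μ m g :=
  sahiE_nonneg_of_sahiPositive_of_absorbing hμ0 hμ1 (by norm_num) h3 m g h01 hmono
    (fun S hS => exists_absorber_of_cardwise g h4 S hS)

end Lifting

section FKG

variable [DistribLattice α]

/-- **Sahi's `C_n` for all `n` under TRIPLEWISE MEET CONTAINMENT ("Theorem F").**  FKG probability weight on a finite distributive lattice;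
monotone `{0,1}`-valued `g_0,…,g_{m−1}` such that among ANY THREE slots one absorbs the product of the other two (events: among any three, one
contains the intersection of the other two).  Then `E_m(g) ≥ 0` — and, the hypothesis passing to sub-families, `E ≥ 0` for every sub-family at
every order.  (= hierarchy lifting from `C_2` = FKG.)  Chains, meet towers, Δ-systems of increasing events, "one slot ⊇ all pairwise meets",
`(x₀x₁, x₀x₂, x₁, x₂)`, … . [this file] -/
theorem sahiE_nonneg_of_triplewise_meetContainment {μ : α → ℝ} (hμ : IsFKGMeasure μ) (m : ℕ) (g : Fin m → α → ℝ)
    (h01 : ∀ i a, g i a = 0 ∨ g i a = 1) (hmono : ∀ i, Monotone (g i))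
    (htri : ∀ S : Finset (Fin m), S.card = 3 → ∃ p ∈ S, ∀ x, (1 - g p x) * ∏ i ∈ S.erase p, g i x = 0) :
    0 ≤ sahiE μ m g :=
  sahiE_nonneg_of_sahiPositive_of_absorbing hμ.nonneg hμ.sum_eq_one (by norm_num) (sahiPositive_two hμ) m g h01 hmono
    (fun S hS => exists_absorber_of_cardwise g htri S hS)

omit [Fintype α] [DistribLattice α] in
/-- Meet towers are triplewise meet-contained (indeed: in every sub-family of size `≥ 3` of a meet tower the EARLIEST slot absorbs the product
of the others). [this file] -/
theorem exists_absorber_of_meetTower {m : ℕ} (g : Fin m → α → ℝ) (h01 : ∀ i a, g i a = 0 ∨ g i a = 1)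
    (htower : ∀ i j k : Fin m, i < j → i < k → j ≠ k → g j * g k * g i = g j * g k)
    (S : Finset (Fin m)) (hS : 3 ≤ S.card) :
    ∃ p ∈ S, ∀ x, (1 - g p x) * ∏ i ∈ S.erase p, g i x = 0 := by
  have hSne : S.Nonempty := Finset.card_pos.mp (by omega)
  refine ⟨S.min' hSne, Finset.min'_mem S hSne, fun x => ?_⟩
  set p := S.min' hSne with hp
  have hcard : 1 < (S.erase p).card := by rw [Finset.card_erase_of_mem (Finset.min'_mem S hSne)]; omega
  obtain ⟨j, hj, k, hk, hjk⟩ := Finset.one_lt_card.mp hcard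
  have hpj : p < j := Finset.min'_lt_of_mem_erase_min' S hSne hj
  have hpk : p < k := Finset.min'_lt_of_mem_erase_min' S hSne hk
  by_cases hprod : ∏ i ∈ S.erase p, g i x = 0
  · rw [hprod, mul_zero]
  · have hall : ∀ i ∈ S.erase p, g i x = 1 := by
      intro i hi
      rcases h01 i x with e | e
      · exact absurd (Finset.prod_eq_zero hi e) hprod
      · exact e
    have key := congrArg (fun F => F x) (htower p j k hpj hpk hjk)
    simp only [Pi.mul_apply, hall j hj, hall k hk, one_mul, mul_one] at key
    rw [key, sub_self, zero_mul]

/-- The tower theorem of `…SahiMeetTowerAllOrders` recovered from hierarchy lifting. [this file] -/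
theorem sahiE_nonneg_of_meetTower' {μ : α → ℝ} (hμ : IsFKGMeasure μ) (m : ℕ) (g : Fin m → α → ℝ)
    (h01 : ∀ i a, g i a = 0 ∨ g i a = 1) (hmono : ∀ i, Monotone (g i))
    (htower : ∀ i j k : Fin m, i < j → i < k → j ≠ k → g j * g k * g i = g j * g k) :
    0 ≤ sahiE μ m g :=
  sahiE_nonneg_of_sahiPositive_of_absorbing hμ.nonneg hμ.sum_eq_one (by norm_num) (sahiPositive_two hμ) m g h01 hmono
    (fun S hS => exists_absorber_of_meetTower g h01 htower S hS)

/-- **A meet tower capped by ANY slot containing its total meet.**  FKG probability weight; `g_0,…,g_m` a meet tower of monotone indicators;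
`d` ANY function with `d ≤ 1` and `(1−d)·∏ g = 0` (for an event: `D ⊇ ⋂_i A_i`, `D` not necessarily monotone).  Then `E_{m+2}(d, g) ≥ 0`
(e.g. `E₄(x₃ ∨ x₀x₁, x₂ ∨ x₀x₁, x₀, x₁) ≥ 0`). [this file] -/
theorem sahiE_cons_nonneg_of_meetTower_of_absorbs_top {μ : α → ℝ} (hμ : IsFKGMeasure μ) (m : ℕ) (d : α → ℝ)
    (g : Fin (m + 1) → α → ℝ) (h01 : ∀ i a, g i a = 0 ∨ g i a = 1) (hmono : ∀ i, Monotone (g i))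
    (htower : ∀ i j k : Fin (m + 1), i < j → i < k → j ≠ k → g j * g k * g i = g j * g k)
    (hd : ∀ a, d a ≤ 1) (htop : ∀ a, (1 - d a) * ∏ i, g i a = 0) :
    0 ≤ sahiE μ (m + 2) (Fin.cons d g : Fin (m + 2) → α → ℝ) := by
  refine sahiE_cons_nonneg_of_absorbs_top hμ.nonneg hμ.sum_eq_one m d g
    (fun i a => by rcases h01 i a with e | e <;> simp [e]) hd htop ?_
  intro T _
  refine SahiMeetTowerAll.sahiE_nonneg_of_meetTower hμ _ _ (fun j a => h01 _ a) (fun j => hmono _) ?_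
  intro i j k hij hik hjk
  exact htower _ _ _ ((Tᶜ.orderEmbOfFin rfl).strictMono hij) ((Tᶜ.orderEmbOfFin rfl).strictMono hik)
    (fun h => hjk ((Tᶜ.orderEmbOfFin rfl).injective h))

/-- Quantitative form: `E_{m+2}(d, g) ≥ (m + 1 − E d)·E_{m+1}(g)` for a meet tower `g` capped by any `d ≤ 1` absorbing its total product.
[this file] -/
theorem sahiE_cons_ge_of_meetTower_of_absorbs_top {μ : α → ℝ} (hμ : IsFKGMeasure μ) (m : ℕ) (d : α → ℝ)
    (g : Fin (m + 1) → α → ℝ) (h01 : ∀ i a, g i a = 0 ∨ g i a = 1) (hmono : ∀ i, Monotone (g i))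
    (htower : ∀ i j k : Fin (m + 1), i < j → i < k → j ≠ k → g j * g k * g i = g j * g k)
    (hd : ∀ a, d a ≤ 1) (htop : ∀ a, (1 - d a) * ∏ i, g i a = 0) :
    (((m : ℝ) + 1) - ex μ d) * sahiE μ (m + 1) g ≤ sahiE μ (m + 2) (Fin.cons d g : Fin (m + 2) → α → ℝ) := by
  refine sahiE_cons_ge_of_absorbs_top hμ.nonneg m d g (fun i a => by rcases h01 i a with e | e <;> simp [e]) hd htop ?_
  intro T _ _
  refine SahiMeetTowerAll.sahiE_nonneg_of_meetTower hμ _ _ (fun j a => h01 _ a) (fun j => hmono _) ?_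
  intro i j k hij hik hjk
  exact htower _ _ _ ((Tᶜ.orderEmbOfFin rfl).strictMono hij) ((Tᶜ.orderEmbOfFin rfl).strictMono hik)
    (fun h => hjk ((Tᶜ.orderEmbOfFin rfl).injective h))

end FKG

/-! ### Kahn's setting: increasing events under a product measure -/

section Product

open Literature.Probability.Percolation.DecisionTree (ind ind_of_mem ind_of_not_mem ind_nonneg)

/-- Indicator families of events: set-containment absorbers give product absorbers. [folklore] -/
theorem exists_absorber_ind {ι : Type*} {m : ℕ} (A : Fin m → Set (Set ι)) (S : Finset (Fin m))
    (h : ∃ q ∈ S, ∀ ω, (∀ i ∈ S.erase q, ω ∈ A i) → ω ∈ A q) :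
    ∃ q ∈ S, ∀ ω, (1 - ind (A q) ω) * ∏ i ∈ S.erase q, ind (A i) ω = 0 := by
  obtain ⟨q, hq, habs⟩ := h
  refine ⟨q, hq, fun ω => ?_⟩
  by_cases hω : ω ∈ A q
  · rw [ind_of_mem hω, sub_self, zero_mul]
  · obtain ⟨i, hi, hiω⟩ : ∃ i ∈ S.erase q, ω ∉ A i := by
      by_contra hcon
      exact hω (habs ω fun i hi => by_contra fun hiω => hcon ⟨i, hi, hiω⟩)
    rw [Finset.prod_eq_zero (f := fun j => ind (A j) ω) hi (ind_of_not_mem hiω), mul_zero]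

/-- **Product measures, increasing events, triplewise meet containment** (Kahn's Conjecture 5 setting, every order): for `p ∈ [0,1]^ι` and
increasing events `A_0,…,A_{m−1} ⊆ 2^ι` such that AMONG ANY THREE ONE CONTAINS THE INTERSECTION OF THE OTHER TWO, Sahi's
`E_m(1_{A_0},…,1_{A_{m−1}}) ≥ 0` under the product weight `bernoulliWeight p` (the point masses of `prodBernoulli p`); likewise for every
sub-family. [this file] -/
theorem bernoulliWeight_sahiE_ind_nonneg_of_triplewise {ι : Type*} [Fintype ι] (p : ι → unitInterval) (m : ℕ)
    (A : Fin m → Set (Set ι)) (hA : ∀ i, IsUpperSet (A i))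
    (htri : ∀ i j k : Fin m, i ≠ j → i ≠ k → j ≠ k → A j ∩ A k ⊆ A i ∨ A i ∩ A k ⊆ A j ∨ A i ∩ A j ⊆ A k) :
    0 ≤ sahiE (bernoulliWeight p) m (fun i => ind (A i)) := by
  refine sahiE_nonneg_of_triplewise_meetContainment (isFKGMeasure_bernoulliWeight p) m _ (fun i ω => ?_)
    (fun i => monotone_ind_of_isUpperSet (hA i)) fun S hS => exists_absorber_ind A S ?_
  · by_cases h : ω ∈ A i
    · exact Or.inr (ind_of_mem h)
    · exact Or.inl (ind_of_not_mem h)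
  · obtain ⟨i, j, k, hij, hik, hjk, rfl⟩ := Finset.card_eq_three.mp hS
    rcases htri i j k hij hik hjk with h | h | h
    · exact ⟨i, by simp, fun ω hω => h ⟨hω j (Finset.mem_erase.mpr ⟨hij.symm, by simp⟩),
        hω k (Finset.mem_erase.mpr ⟨hik.symm, by simp⟩)⟩⟩
    · exact ⟨j, by simp, fun ω hω => h ⟨hω i (Finset.mem_erase.mpr ⟨hij, by simp⟩),
        hω k (Finset.mem_erase.mpr ⟨hjk.symm, by simp⟩)⟩⟩
    · exact ⟨k, by simp, fun ω hω => h ⟨hω i (Finset.mem_erase.mpr ⟨hik, by simp⟩),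
        hω j (Finset.mem_erase.mpr ⟨hjk, by simp⟩)⟩⟩

end Product

end SahiHereditaryMeetAbsorption

end Summit.CriticalPhenomena.PercolationContinuityZ3.Theorems
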